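import Summits.BirchSwinnertonDyer.BirchSwinnertonDyer.Theorems.ByReductionTypeAtTwoSupersingularFlatRoadDoor
import HarnessLib

/-!
# Crux `SupersingularRankZeroAtTwo` (item stmt-BirchSwinnertonDyer-19097, route `ByReductionTypeAtTwo`, rung K4): the
# UNIT-ANCHOR TRANSPORT road on Sprung's `♭` objects — the Kato half of ANY good-supersingular-at-2 curve (`a₂ ∈ {0, ±2}`)
# from a congruent unit-zone anchor with the SAME `a₂`, the `♭` `μ`-transport at the pair, and lane A's rational
# `♭` Coleman–Kato package — NO `TwoAdicSurjective`/F4@(2) clause, NO CM (seat `bsd-2adic-ss-1x` GEN 4; `♭` twin of p558810)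

HONEST FRAMING (cells `bsd-2adic` / `bsd-wall`; HUMAN RULINGS D-0036/D-0054/D-0074): THEOREMS ONLY — no definition, no named fact,
no instance, no `sorry`; every research input is an explicit hypothesis on SUPPLIED local data; closes no item; BSD is NOT proved by
any of this. PARTITION (D-0054): X5@2 good-supersingular, UNIT-ANCHOR sub-row (62/757 rank-`0` classes: 17 with `a₂ = 0`, 43 with
`a₂ = +2`, 2 with `a₂ = −2`; UNIT-ANCHOR-CENSUS-v1, kit j287435) × `p = 2` — types-the-object-of; bears_on K4 19097.

WHAT. Lane A's `♭` road (`SSFlatRoad.flatUpper_two_of_flatColemanKato_of_mu` → `missingUpperBoundAt_two_of_flatUpper`, seat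
`bsd-2adic-ss-1`) derives the Miller UPPER half from the `♭` Coleman–Kato package, the `♭` `Γ`-Euler characteristic and EITHER the
F4@(2) clause under `TwoAdicSurjective` OR `μ(X^♭) = 0` (`hμ : char X^♭ = (g') → 2 ∤ g'`). This file supplies the `μ = 0` input by
TRANSPORT FROM A UNIT-ZONE ANCHOR, exactly as p558810 does on Kobayashi's `±` objects for `a₂ = 0`:
* §1 `flatUpper_two_of_flatColemanKatoRat_of_mu` — lane A's `_of_mu` theorem restated for the RATIONAL package (the hypothesis
  WITHOUT its guarded `TwoAdicSurjective W → …` conjunct, which `_of_mu` never uses): no F4@(2) is displayed downstream.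
* §2 `not_C_dvd_of_flatEulerChar_of_unitZone` — at an anchor `A` with `L(A,1) ≠ 0`, `2 ∤ ∏c_ℓ(A)`, `2 ∤ #Ш(A)`: the `♭` `Γ`-Euler
  characteristic (Kim/Sprung formula `g'(0) ∼ 2^{v₂∏c}·#Sel_{2^∞}`, lane A's `hEC` shape) makes the constant term of every generator
  of `char X^♭(A)` a `2`-adic unit (`valuation_constantCoeff_xi`), so `2 ∤ g'` — `μ^♭(A) = 0` from control ALONE.
* §3 `missingUpperBoundAt_two_of_unitAnchor_flat` — the pair door: anchor §2 + the `♭` `μ`-TRANSPORT binder at the pair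
  (`hmuT`: B. D. Kim 2009 Cor. 2.13 `μ`-half READ AT `2` for Sprung's `♭` Selmer groups of two curves with the same `a₂` and
  `W[2] ≅ A[2]` — research) + §1 at `W` + lane A's door ⟹ `MissingUpperBoundAt W 2`; `bsdp_two_of_unitAnchor_flat` adds `hsha`.
RESEARCH CONTENT per class: {`hmuT`, EC♭ at `W` and at `A` (with the control-finiteness clause at `A`), the rational `♭`
Coleman–Kato package at `W`}; CERT {unit zone of `A`, `W[2] ≅ A[2]`, `hsha`}; PUB {hmod, hGZK, h124, hX0}.

References: [Sprung2012] Thm. 7.14, 7.16, Conj. 7.21; [Sprung2024] §5.2 Lemmas 5.5–5.9; [Sprung2017] Cor. 4.11; [BDKim2009] Cor. 2.13;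
[GreenbergVatsal2000] Thm. (1.4), p. 2; [Kato2004Asterisque] Thm. 12.4–12.5 (3); [Miller2011LMS] Def. 1.1; UNIT-ANCHOR-CENSUS-v1.md.
-/

set_option autoImplicit false
-- the Theorems namespace of this sub repeats the summit name by design (D-0017 nested layout)
set_option linter.dupNamespace false

noncomputable section

open scoped Classical MatrixGroups ModularForm

open CongruenceSubgroup WeierstrassCurve Literature.NumberTheory.EllipticCurves
  Literature.NumberTheory.EllipticCurves.ModularForms Literature.NumberTheory.EllipticCurves.Sprung2017
  Literature.NumberTheory.EllipticCurves.Sprung2012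
  Literature.NumberTheory.EllipticCurves.Rank1Residual Literature.NumberTheory.EllipticCurves.Rank1Residual.Typed
  Literature.NumberTheory.EllipticCurves.IwasawaDual Literature.NumberTheory.GaloisRepresentations
  ZpExtension Summit.BirchSwinnertonDyer.Rank1Residual Summit.BirchSwinnertonDyer.Rank1Residual.Supersingular
  Summit.BirchSwinnertonDyer.Rank1Residual.X5.O1

universe u

namespace Summit.BirchSwinnertonDyer.BirchSwinnertonDyer.Theorems

namespace SSUnitAnchor

/-! ## §1 The `♭` upper divisibility at `2` from the RATIONAL `♭` Coleman–Kato package and `μ^♭ = 0` -/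

section OneCurve

variable (W : WeierstrassCurve ℚ) [W.IsElliptic] [W.IsGloballyMinimal]
  {κ : ZpExtension ℚ 2} {γ : Field.absoluteGaloisGroup ℚ}
  {E : Type} [Field E] [Algebra ℚ E] (ι : AlgebraicClosure ℚ →ₐ[ℚ] AlgebraicClosure E)
  (g : Field.absoluteGaloisGroup E) (c : ℕ → localPoints W E)

/-- **`SSFlatRoad.flatUpper_two_of_flatColemanKato_of_mu` on the RATIONAL package.** Same statement and proof as lane A's
theorem, with the `♭` Coleman–Kato hypothesis `hCK` carrying NO `TwoAdicSurjective W → …` conjunct (F1♭ exactness, `G ∈ Col♭(loc Z)`,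
F3♭ `ι G = ϖ·ι L♭`, F4rat at height-one `𝔭 ∌ 2` only): with `μ^♭ = 0` (`hμ`) the `2^m`-divisibility from Kato's skeleton is an exact
`♭` upper divisibility `char X^♭ = (g')`, `ι(g'·h) = ϖ·ι L♭`. [cite: Sprung2012, Thm. 7.14 and Thm. 7.16 (p. 1504)]
[cite: Kato2004Asterisque, Thm. 12.4 and Thm. 12.5 (3)] [cite: GreenbergVatsal2000, p. 2, (1)–(2)] -/
theorem flatUpper_two_of_flatColemanKatoRat_of_mu (h124 : Kato2004.thm12_4)
    (hX0 : Kato2004_fineSelmerDual_isTorsion)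
    (hgood : W.HasGoodReductionAtPrime 2) (hss : (2 : ℤ) ∣ W.frobeniusTrace 2)
    (hL : W.entireLFunction 1 ≠ 0)
    (hκ : κ.IsCyclotomic) (hγ : κ.IsTopGenerator γ)
    (hCK : ∀ [NeZero (W.conductorNorm ℤ)] (f : CuspForm (Gamma0 (W.conductorNorm ℤ)) 2),
        IsNewformOf W f → ∀ (ϖ : ℚ), (ϖ : ℝ) * W.realPeriodRat = plusPeriod f →
      ∀ (Ls Lf : IwasawaAlgebra 2), IsSprungPair f 2 (W.frobeniusTrace 2) Ls Lf →
      ∀ (D : SharpFlatSelmerDualData W κ γ ι (W.frobeniusTrace 2) g c .flat)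
        [ContinuousSMul ℤ_[2] (W.tateModule 2)],
        ∃ (I : Kato2004.IwasawaH1Data W 2 κ γ) (Y : W.FineSelmerDualData κ γ)
          (P : Submodule (IwasawaAlgebra 2) (IwasawaAlgebra 2))
          (loc : I.H →ₗ[IwasawaAlgebra 2] P) (toX : P →ₗ[IwasawaAlgebra 2] D.X)
          (δ : D.X →ₗ[IwasawaAlgebra 2] Y.X) (Z : Submodule (IwasawaAlgebra 2) I.H)
          (G : IwasawaAlgebra 2),
          Function.Exact loc toX ∧ Function.Exact toX δ ∧
          G ∈ Submodule.map (P.subtype ∘ₗ loc) Z ∧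
          iwasawaToPowerSeries 2 G = PowerSeries.C (ϖ : ℚ_[2]) * iwasawaToPowerSeries 2 Lf ∧
          (∀ 𝔭 : PrimeSpectrum (IwasawaAlgebra 2), 𝔭.asIdeal.height = 1 →
            PowerSeries.C (2 : ℤ_[2]) ∉ 𝔭.asIdeal →
            Literature.NumberTheory.EllipticCurves.Module.lengthAt (IwasawaAlgebra 2) Y.X 𝔭 ≤
              Literature.NumberTheory.EllipticCurves.Module.lengthAt (IwasawaAlgebra 2) (I.H ⧸ Z) 𝔭))
    (hμ : ∀ (D : SharpFlatSelmerDualData W κ γ ι (W.frobeniusTrace 2) g c .flat) (g' : IwasawaAlgebra 2),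
        D.charIdeal = Ideal.span {g'} → ¬ PowerSeries.C (2 : ℤ_[2]) ∣ g') :
    ∀ [NeZero (W.conductorNorm ℤ)] (f : CuspForm (Gamma0 (W.conductorNorm ℤ)) 2),
        IsNewformOf W f → ∀ (ϖ : ℚ), (ϖ : ℝ) * W.realPeriodRat = plusPeriod f →
      ∀ (Ls Lf : IwasawaAlgebra 2), IsSprungPair f 2 (W.frobeniusTrace 2) Ls Lf →
      ∀ (D : SharpFlatSelmerDualData W κ γ ι (W.frobeniusTrace 2) g c .flat),
        Module.IsTorsion (IwasawaAlgebra 2) D.X ∧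
        ∃ g' h : IwasawaAlgebra 2, D.charIdeal = Ideal.span {g'} ∧
          iwasawaToPowerSeries 2 (g' * h) = PowerSeries.C (ϖ : ℚ_[2]) * iwasawaToPowerSeries 2 Lf := by
  intro _ f hf ϖ hϖ Ls Lf hSP D
  haveI : ContinuousSMul ℤ_[2] (W.tateModule 2) := TateModule.continuousSMul_padicInt
  obtain ⟨I, Y, P, loc, toX, δ, Z, G, hPX, hXY, hGZ, hιG, hESrat⟩ := hCK f hf ϖ hϖ Ls Lf hSP D
  have hY : Module.IsTorsion (IwasawaAlgebra 2) Y.X := hX0 W 2 κ γ hκ hγ Y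
  obtain ⟨htf, hrank⟩ := h124.isTorsionFree_and_rank_le_one W 2 hκ hγ I
  haveI := htf
  have hLf : Lf ≠ 0 := SSFlatRoad.flat_ne_zero_two W hf hgood hss hL hSP
  have hϖ0 : ϖ ≠ 0 := by
    intro h0
    apply hL
    rw [hf.entireLFunction_one_eq, ← hϖ, h0]
    simp
  have hG : G ≠ 0 := by
    intro h0
    rw [h0, map_zero] at hιG
    have h1 : PowerSeries.C (ϖ : ℚ_[2]) * iwasawaToPowerSeries 2 Lf ≠ 0 := by
      refine mul_ne_zero ?_ ?_
      · intro hC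
        have := congrArg PowerSeries.constantCoeff hC
        simp only [PowerSeries.constantCoeff_C, map_zero] at this
        exact hϖ0 (by exact_mod_cast this)
      · intro hz
        exact hLf ((iwasawaToPowerSeries_injective 2) (by rw [hz, map_zero]))
    exact h1 hιG.symm
  obtain ⟨htors, m, hm⟩ := SSFlatRoad.exists_pow_mul_mem_charIdeal_of_colemanSkeletonRat' hγ I hrank Y D loc
    P.subtype P.injective_subtype toX δ hPX hXY hY Z hG hGZ
    (fun 𝔭 h1 hp𝔭 ↦ hESrat 𝔭 h1 (by simpa using hp𝔭))
  refine ⟨htors, ?_⟩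
  obtain ⟨g', hg⟩ := (charIdeal_isPrincipal_holds 2 D.X).principal
  have hg' : D.charIdeal = Ideal.span {g'} := hg
  have h2C : (PowerSeries.C ((2 : ℕ) : ℤ_[2]) : IwasawaAlgebra 2) = PowerSeries.C (2 : ℤ_[2]) := by
    simp
  rw [h2C, hg'] at hm
  have hdvd : g' ∣ PowerSeries.C (2 : ℤ_[2]) ^ m * G := Ideal.mem_span_singleton.mp hm
  have h2 : Prime (PowerSeries.C (2 : ℤ_[2]) : IwasawaAlgebra 2) := by
    rw [← h2C]; exact IwasawaAlgebra.prime_C 2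
  obtain ⟨h, hh⟩ := SSColemanRoad.dvd_of_dvd_C_pow_mul_of_not_dvd h2 (hμ D g' hg') hdvd
  exact ⟨g', h, hg', by rw [← hh]; exact hιG⟩

end OneCurve

/-! ## §2 At the ANCHOR: the double unit zone ⇒ `2 ∤ g'` for every generator of `char X^♭(A/ℚ_∞)`, from control alone -/

section Anchor

variable (A : WeierstrassCurve ℚ) [A.IsElliptic] [A.IsGloballyMinimal]
  {κ : ZpExtension ℚ 2} {γ : Field.absoluteGaloisGroup ℚ}
  {E : Type} [Field E] [Algebra ℚ E] (ι : AlgebraicClosure ℚ →ₐ[ℚ] AlgebraicClosure E)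
  (g : Field.absoluteGaloisGroup E) (cA : ℕ → localPoints A E)

/-- **The UNIT-ZONE anchor on `♭` objects needs no main conjecture.** For `A` with `L(A,1) ≠ 0` (GZK), `2 ∤ ∏c_ℓ(A)`,
`2 ∤ #Ш(A)`, and for the supplied data: the control-finiteness clause (`hfin`: `Sel_{2^∞}(A/ℚ)` finite ⇒ `Sel^♭(A/ℚ_∞)^γ`
finite — so every dual datum is torsion, Greenberg's Thm. 1.4 mechanism `SharpFlatSelmerDualData.isTorsion_of_finite_endInvariants`)
and the `♭` `Γ`-Euler characteristic (`hEC`, lane A's shape): every generator `g'` of `char X^♭(A/ℚ_∞)` has a `2`-ADIC UNIT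
constant term (`valuation_constantCoeff_xi`: `v₂ g'(0) = v₂∏c + v₂#Ш = 0`), hence `2 ∤ g'` — i.e. `μ^♭(A) = 0` in lane A's
currency. No `L`-value beyond `L(A,1) ≠ 0`, no period, no CM. [cite: Sprung2024, §5.2 Lemmas 5.5–5.9]
[cite: GreenbergLNM1716, Thm. 1.4 (p. 61)] [cite: GreenbergVatsal2000, p. 2, (1)–(2)] -/
theorem not_C_dvd_of_flatEulerChar_of_unitZone (hGZK : rank_eq_analyticRank_of_analyticRank_le_one)
    (hLA : A.entireLFunction 1 ≠ 0) (hγ : κ.IsTopGenerator γ)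
    (hfin : Finite (A.selmerGroupPInfty 2) →
      Finite (endInvariants (conjSharpFlatSelmerInfty A κ ι (A.frobeniusTrace 2) g cA .flat γ - 1)))
    (hEC : ∀ (D : SharpFlatSelmerDualData A κ γ ι (A.frobeniusTrace 2) g cA .flat)
        [Module.Finite (IwasawaAlgebra 2) D.X], Module.IsTorsion (IwasawaAlgebra 2) D.X →
      ∀ f : IwasawaAlgebra 2, D.charIdeal = Ideal.span {f} → Finite (A.selmerGroupPInfty 2) →
        ∃ u : ℤ_[2]ˣ, ((PowerSeries.constantCoeff f : ℤ_[2]) : ℚ_[2]) =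
          ((u : ℤ_[2]) : ℚ_[2]) * ((2 : ℕ) : ℚ_[2]) ^ (padicValNat 2 A.tamagawaProduct) *
            (Nat.card (A.selmerGroupPInfty 2) : ℚ_[2]))
    (hTam : ¬ 2 ∣ A.tamagawaProduct) (hSha : ¬ 2 ∣ A.shaOrder) :
    ∀ (D : SharpFlatSelmerDualData A κ γ ι (A.frobeniusTrace 2) g cA .flat) (g' : IwasawaAlgebra 2),
      Module.IsTorsion (IwasawaAlgebra 2) D.X ∧
        (D.charIdeal = Ideal.span {g'} → ¬ PowerSeries.C (2 : ℤ_[2]) ∣ g') := by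
  intro D g'
  haveI : Module.Finite (IwasawaAlgebra 2) D.X := D.moduleFinite hγ
  have hr : A.analyticRank = 0 := analyticRank_eq_zero_of_entireLFunction_one_ne_zero A hLA
  have hSel : Finite (A.selmerGroupPInfty 2) := finite_selmerGroupPInfty_of_analyticRank_eq_zero hGZK A 2 hr
  have hTors : Module.IsTorsion (IwasawaAlgebra 2) D.X := D.isTorsion_of_finite_endInvariants hγ (hfin hSel)
  refine ⟨hTors, fun hchar hdvd ↦ ?_⟩
  have hK : (⟨g', 0, 0⟩ : SignedDatum A 2).EulerCharacteristic := fun hfin' ↦ by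
    simpa using hEC D hTors g' hchar hfin'
  obtain ⟨hne, hval⟩ := valuation_constantCoeff_xi A 2 hGZK hLA ⟨g', 0, 0⟩ hK
  change ((PowerSeries.constantCoeff g' : ℤ_[2]) : ℚ_[2]) ≠ 0 at hne
  change (((PowerSeries.constantCoeff g' : ℤ_[2]) : ℚ_[2])).valuation = _ at hval
  rw [padicValNat.eq_zero_of_not_dvd hTam, padicValNat.eq_zero_of_not_dvd hSha] at hval
  -- `2 ∣ g'` would give the constant term valuation `≥ 1`
  obtain ⟨q, rfl⟩ := hdvd
  have hc : PowerSeries.constantCoeff (PowerSeries.C (2 : ℤ_[2]) * q) = 2 * PowerSeries.constantCoeff q := by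
    rw [map_mul, PowerSeries.constantCoeff_C]
  rw [hc] at hne hval
  have hq0 : ((PowerSeries.constantCoeff q : ℤ_[2]) : ℚ_[2]) ≠ 0 := by
    intro h0; apply hne; push_cast; rw [h0, mul_zero]
  have h2 : ((2 : ℤ_[2]) : ℚ_[2]) ≠ 0 := by norm_num
  have hval' : (((2 : ℤ_[2]) * PowerSeries.constantCoeff q : ℤ_[2]) : ℚ_[2]).valuation =
      ((2 : ℚ_[2])).valuation + (((PowerSeries.constantCoeff q : ℤ_[2]) : ℚ_[2])).valuation := by
    push_cast
    exact Padic.valuation_mul h2 hq0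
  have hv2 : ((2 : ℚ_[2])).valuation = 1 := by
    have := @Padic.valuation_p 2 _
    exact_mod_cast this
  have hnn := valuation_coe_padicInt_nonneg (PowerSeries.constantCoeff q) hq0
  rw [hval', hv2] at hval
  push_cast at hval
  omega

end Anchor

/-! ## §3 The pair `(W, A)` on `♭` objects: the Kato half of `W` from a unit-zone anchor with the same `a₂` -/

section Pair

variable (W : WeierstrassCurve ℚ) [W.IsElliptic] [W.IsGloballyMinimal]
  (A : WeierstrassCurve ℚ) [A.IsElliptic] [A.IsGloballyMinimal]
  {κ : ZpExtension ℚ 2} {γ : Field.absoluteGaloisGroup ℚ}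
  {E : Type} [Field E] [Algebra ℚ E] (ι : AlgebraicClosure ℚ →ₐ[ℚ] AlgebraicClosure E)
  (g : Field.absoluteGaloisGroup E) (c : ℕ → localPoints W E) (cA : ℕ → localPoints A E)

/-- **UNIT-ANCHOR TRANSPORT on `♭` objects, upper half** (any `a₂ ∈ {0, ±2}`). `W` good supersingular at `2` with
`L(W,1) ≠ 0`; `A` good supersingular at `2` with the SAME `a₂`, `L(A,1) ≠ 0`, `2 ∤ ∏c_ℓ(A)`, `2 ∤ #Ш(A)`; `W[2] ≃ A[2]` equivariantly
(`e`, `he`); supplied cyclotomic data `(κ, γ)` and local data `(ι, g, c)` for `W`, `(ι, g, c_A)` for `A`. Binders: PUB {`hmod`, `hGZK`,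
`h124`, `hX0`}; AT `W`: EC♭ `hEC`, the RATIONAL `♭` Coleman–Kato package `hCK`; AT `A`: control-finiteness `hfinA` and EC♭ `hECA`;
AT THE PAIR: `hmuT` = B. D. Kim 2009 Cor. 2.13 `μ`-half READ AT `2` for Sprung's `♭` Selmer groups («`2 ∤` every generator of
`char X^♭(A)` ⇒ `2 ∤` every generator of `char X^♭(W)`», research). ⟹ `MissingUpperBoundAt W 2` via §2, `hmuT`, §1 and lane A's
`SSFlatRoad.missingUpperBoundAt_two_of_flatUpper`. No `TwoAdicSurjective`, no F4@(2), no CM. [cite: BDKim2009, Cor. 2.13]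
[cite: Sprung2012, Thm. 7.14 and Thm. 7.16] [cite: Sprung2024, §5.2 Lemmas 5.5–5.9] [cite: Kato2004Asterisque, Thm. 12.4–12.5 (3)]
[cite: Miller2011LMS, Def. 1.1] -/
theorem missingUpperBoundAt_two_of_unitAnchor_flat (hmod : nonempty_modularParametrizationData)
    (hGZK : rank_eq_analyticRank_of_analyticRank_le_one)
    (h124 : Kato2004.thm12_4) (hX0 : Kato2004_fineSelmerDual_isTorsion)
    (hgood : W.HasGoodReductionAtPrime 2) (hss : (2 : ℤ) ∣ W.frobeniusTrace 2) (hL : W.entireLFunction 1 ≠ 0)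
    (hAgood : A.HasGoodReductionAtPrime 2) (ha : W.frobeniusTrace 2 = A.frobeniusTrace 2) (hLA : A.entireLFunction 1 ≠ 0)
    (hTam : ¬ 2 ∣ A.tamagawaProduct) (hSha : ¬ 2 ∣ A.shaOrder)
    (e : WeierstrassCurve.geomTorsion W (2 : ℤ) ≃+ WeierstrassCurve.geomTorsion A (2 : ℤ))
    (he : ∀ (σ : Field.absoluteGaloisGroup ℚ) (P : WeierstrassCurve.geomTorsion W (2 : ℤ)), e (σ • P) = σ • e P)
    (hκ : κ.IsCyclotomic) (hγ : κ.IsTopGenerator γ)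
    (hEC : ∀ (D : SharpFlatSelmerDualData W κ γ ι (W.frobeniusTrace 2) g c .flat)
        [Module.Finite (IwasawaAlgebra 2) D.X], Module.IsTorsion (IwasawaAlgebra 2) D.X →
      ∀ f : IwasawaAlgebra 2, D.charIdeal = Ideal.span {f} → Finite (W.selmerGroupPInfty 2) →
        ∃ u : ℤ_[2]ˣ, ((PowerSeries.constantCoeff f : ℤ_[2]) : ℚ_[2]) =
          ((u : ℤ_[2]) : ℚ_[2]) * ((2 : ℕ) : ℚ_[2]) ^ (padicValNat 2 W.tamagawaProduct) *
            (Nat.card (W.selmerGroupPInfty 2) : ℚ_[2]))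
    (hCK : ∀ [NeZero (W.conductorNorm ℤ)] (f : CuspForm (Gamma0 (W.conductorNorm ℤ)) 2),
        IsNewformOf W f → ∀ (ϖ : ℚ), (ϖ : ℝ) * W.realPeriodRat = plusPeriod f →
      ∀ (Ls Lf : IwasawaAlgebra 2), IsSprungPair f 2 (W.frobeniusTrace 2) Ls Lf →
      ∀ (D : SharpFlatSelmerDualData W κ γ ι (W.frobeniusTrace 2) g c .flat)
        [ContinuousSMul ℤ_[2] (W.tateModule 2)],
        ∃ (I : Kato2004.IwasawaH1Data W 2 κ γ) (Y : W.FineSelmerDualData κ γ)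
          (P : Submodule (IwasawaAlgebra 2) (IwasawaAlgebra 2))
          (loc : I.H →ₗ[IwasawaAlgebra 2] P) (toX : P →ₗ[IwasawaAlgebra 2] D.X)
          (δ : D.X →ₗ[IwasawaAlgebra 2] Y.X) (Z : Submodule (IwasawaAlgebra 2) I.H)
          (G : IwasawaAlgebra 2),
          Function.Exact loc toX ∧ Function.Exact toX δ ∧
          G ∈ Submodule.map (P.subtype ∘ₗ loc) Z ∧
          iwasawaToPowerSeries 2 G = PowerSeries.C (ϖ : ℚ_[2]) * iwasawaToPowerSeries 2 Lf ∧
          (∀ 𝔭 : PrimeSpectrum (IwasawaAlgebra 2), 𝔭.asIdeal.height = 1 →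
            PowerSeries.C (2 : ℤ_[2]) ∉ 𝔭.asIdeal →
            Literature.NumberTheory.EllipticCurves.Module.lengthAt (IwasawaAlgebra 2) Y.X 𝔭 ≤
              Literature.NumberTheory.EllipticCurves.Module.lengthAt (IwasawaAlgebra 2) (I.H ⧸ Z) 𝔭))
    (hfinA : Finite (A.selmerGroupPInfty 2) →
      Finite (endInvariants (conjSharpFlatSelmerInfty A κ ι (A.frobeniusTrace 2) g cA .flat γ - 1)))
    (hECA : ∀ (D : SharpFlatSelmerDualData A κ γ ι (A.frobeniusTrace 2) g cA .flat)
        [Module.Finite (IwasawaAlgebra 2) D.X], Module.IsTorsion (IwasawaAlgebra 2) D.X →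
      ∀ f : IwasawaAlgebra 2, D.charIdeal = Ideal.span {f} → Finite (A.selmerGroupPInfty 2) →
        ∃ u : ℤ_[2]ˣ, ((PowerSeries.constantCoeff f : ℤ_[2]) : ℚ_[2]) =
          ((u : ℤ_[2]) : ℚ_[2]) * ((2 : ℕ) : ℚ_[2]) ^ (padicValNat 2 A.tamagawaProduct) *
            (Nat.card (A.selmerGroupPInfty 2) : ℚ_[2]))
    (hmuT : W.HasGoodReductionAtPrime 2 → A.HasGoodReductionAtPrime 2 → W.frobeniusTrace 2 = A.frobeniusTrace 2 →
      (∃ e : WeierstrassCurve.geomTorsion W (2 : ℤ) ≃+ WeierstrassCurve.geomTorsion A (2 : ℤ),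
        ∀ (σ : Field.absoluteGaloisGroup ℚ) (P : WeierstrassCurve.geomTorsion W (2 : ℤ)), e (σ • P) = σ • e P) →
      (∀ (D' : SharpFlatSelmerDualData A κ γ ι (A.frobeniusTrace 2) g cA .flat) (g' : IwasawaAlgebra 2),
          Module.IsTorsion (IwasawaAlgebra 2) D'.X ∧ (D'.charIdeal = Ideal.span {g'} → ¬ PowerSeries.C (2 : ℤ_[2]) ∣ g')) →
      ∀ (D : SharpFlatSelmerDualData W κ γ ι (W.frobeniusTrace 2) g c .flat) (g' : IwasawaAlgebra 2),
        D.charIdeal = Ideal.span {g'} → ¬ PowerSeries.C (2 : ℤ_[2]) ∣ g') :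
    MissingUpperBoundAt W 2 := by
  have hμA := not_C_dvd_of_flatEulerChar_of_unitZone A ι g cA hGZK hLA hγ hfinA hECA hTam hSha
  have hμW := hmuT hgood hAgood ha ⟨e, he⟩ hμA
  exact SSFlatRoad.missingUpperBoundAt_two_of_flatUpper W ι g c hmod hGZK hgood hss hL hγ hEC
    (flatUpper_two_of_flatColemanKatoRat_of_mu W ι g c h124 hX0 hgood hss hL hκ hγ hCK hμW)

/-- **UNIT-ANCHOR TRANSPORT on `♭` objects, BSD₂.** The upper half `missingUpperBoundAt_two_of_unitAnchor_flat` plus the class's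
Miller LOWER half `hsha : MissingLowerBoundAt W 2` ⟹ `BSDp W 2`. [cite: Miller2011LMS, Def. 1.1 and Thm. 1.3]
[cite: BDKim2009, Cor. 2.13] [cite: Sprung2012, Thm. 7.16] [cite: Kato2004Asterisque, Thm. 12.5 (3)] -/
theorem bsdp_two_of_unitAnchor_flat (hmod : nonempty_modularParametrizationData)
    (hGZK : rank_eq_analyticRank_of_analyticRank_le_one)
    (h124 : Kato2004.thm12_4) (hX0 : Kato2004_fineSelmerDual_isTorsion)
    (hgood : W.HasGoodReductionAtPrime 2) (hss : (2 : ℤ) ∣ W.frobeniusTrace 2) (hL : W.entireLFunction 1 ≠ 0)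
    (hAgood : A.HasGoodReductionAtPrime 2) (ha : W.frobeniusTrace 2 = A.frobeniusTrace 2) (hLA : A.entireLFunction 1 ≠ 0)
    (hTam : ¬ 2 ∣ A.tamagawaProduct) (hSha : ¬ 2 ∣ A.shaOrder)
    (e : WeierstrassCurve.geomTorsion W (2 : ℤ) ≃+ WeierstrassCurve.geomTorsion A (2 : ℤ))
    (he : ∀ (σ : Field.absoluteGaloisGroup ℚ) (P : WeierstrassCurve.geomTorsion W (2 : ℤ)), e (σ • P) = σ • e P)
    (hκ : κ.IsCyclotomic) (hγ : κ.IsTopGenerator γ)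
    (hEC : ∀ (D : SharpFlatSelmerDualData W κ γ ι (W.frobeniusTrace 2) g c .flat)
        [Module.Finite (IwasawaAlgebra 2) D.X], Module.IsTorsion (IwasawaAlgebra 2) D.X →
      ∀ f : IwasawaAlgebra 2, D.charIdeal = Ideal.span {f} → Finite (W.selmerGroupPInfty 2) →
        ∃ u : ℤ_[2]ˣ, ((PowerSeries.constantCoeff f : ℤ_[2]) : ℚ_[2]) =
          ((u : ℤ_[2]) : ℚ_[2]) * ((2 : ℕ) : ℚ_[2]) ^ (padicValNat 2 W.tamagawaProduct) *
            (Nat.card (W.selmerGroupPInfty 2) : ℚ_[2]))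
    (hCK : ∀ [NeZero (W.conductorNorm ℤ)] (f : CuspForm (Gamma0 (W.conductorNorm ℤ)) 2),
        IsNewformOf W f → ∀ (ϖ : ℚ), (ϖ : ℝ) * W.realPeriodRat = plusPeriod f →
      ∀ (Ls Lf : IwasawaAlgebra 2), IsSprungPair f 2 (W.frobeniusTrace 2) Ls Lf →
      ∀ (D : SharpFlatSelmerDualData W κ γ ι (W.frobeniusTrace 2) g c .flat)
        [ContinuousSMul ℤ_[2] (W.tateModule 2)],
        ∃ (I : Kato2004.IwasawaH1Data W 2 κ γ) (Y : W.FineSelmerDualData κ γ)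
          (P : Submodule (IwasawaAlgebra 2) (IwasawaAlgebra 2))
          (loc : I.H →ₗ[IwasawaAlgebra 2] P) (toX : P →ₗ[IwasawaAlgebra 2] D.X)
          (δ : D.X →ₗ[IwasawaAlgebra 2] Y.X) (Z : Submodule (IwasawaAlgebra 2) I.H)
          (G : IwasawaAlgebra 2),
          Function.Exact loc toX ∧ Function.Exact toX δ ∧
          G ∈ Submodule.map (P.subtype ∘ₗ loc) Z ∧
          iwasawaToPowerSeries 2 G = PowerSeries.C (ϖ : ℚ_[2]) * iwasawaToPowerSeries 2 Lf ∧
          (∀ 𝔭 : PrimeSpectrum (IwasawaAlgebra 2), 𝔭.asIdeal.height = 1 →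
            PowerSeries.C (2 : ℤ_[2]) ∉ 𝔭.asIdeal →
            Literature.NumberTheory.EllipticCurves.Module.lengthAt (IwasawaAlgebra 2) Y.X 𝔭 ≤
              Literature.NumberTheory.EllipticCurves.Module.lengthAt (IwasawaAlgebra 2) (I.H ⧸ Z) 𝔭))
    (hfinA : Finite (A.selmerGroupPInfty 2) →
      Finite (endInvariants (conjSharpFlatSelmerInfty A κ ι (A.frobeniusTrace 2) g cA .flat γ - 1)))
    (hECA : ∀ (D : SharpFlatSelmerDualData A κ γ ι (A.frobeniusTrace 2) g cA .flat)
        [Module.Finite (IwasawaAlgebra 2) D.X], Module.IsTorsion (IwasawaAlgebra 2) D.X →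
      ∀ f : IwasawaAlgebra 2, D.charIdeal = Ideal.span {f} → Finite (A.selmerGroupPInfty 2) →
        ∃ u : ℤ_[2]ˣ, ((PowerSeries.constantCoeff f : ℤ_[2]) : ℚ_[2]) =
          ((u : ℤ_[2]) : ℚ_[2]) * ((2 : ℕ) : ℚ_[2]) ^ (padicValNat 2 A.tamagawaProduct) *
            (Nat.card (A.selmerGroupPInfty 2) : ℚ_[2]))
    (hmuT : W.HasGoodReductionAtPrime 2 → A.HasGoodReductionAtPrime 2 → W.frobeniusTrace 2 = A.frobeniusTrace 2 →
      (∃ e : WeierstrassCurve.geomTorsion W (2 : ℤ) ≃+ WeierstrassCurve.geomTorsion A (2 : ℤ),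
        ∀ (σ : Field.absoluteGaloisGroup ℚ) (P : WeierstrassCurve.geomTorsion W (2 : ℤ)), e (σ • P) = σ • e P) →
      (∀ (D' : SharpFlatSelmerDualData A κ γ ι (A.frobeniusTrace 2) g cA .flat) (g' : IwasawaAlgebra 2),
          Module.IsTorsion (IwasawaAlgebra 2) D'.X ∧ (D'.charIdeal = Ideal.span {g'} → ¬ PowerSeries.C (2 : ℤ_[2]) ∣ g')) →
      ∀ (D : SharpFlatSelmerDualData W κ γ ι (W.frobeniusTrace 2) g c .flat) (g' : IwasawaAlgebra 2),
        D.charIdeal = Ideal.span {g'} → ¬ PowerSeries.C (2 : ℤ_[2]) ∣ g')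
    (hsha : MissingLowerBoundAt W 2) : BSDp W 2 :=
  bsdp_of_missingPPartAt W 2 hGZK ((analyticRank_eq_zero_of_entireLFunction_one_ne_zero W hL).le.trans zero_le_one)
    (missingPPartAt_of_lower_of_upper W 2 hsha
      (missingUpperBoundAt_two_of_unitAnchor_flat W A ι g c cA hmod hGZK h124 hX0 hgood hss hL hAgood ha hLA hTam hSha e he
        hκ hγ hEC hCK hfinA hECA hmuT))

end Pair

end SSUnitAnchor

end Summit.BirchSwinnertonDyer.BirchSwinnertonDyer.Theorems

end
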